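import Summits.Ventures.HSemireg.WedgeHankelRecurrenceInterlacing

/-!
# Venture HSemireg — THE VERTEX (ENVELOPE) LEMMAS BEHIND KHARITONOV'S THEOREM: **a real `p = h(X²) + X·g(X²)` is Hurwitz iff a finite set of SIGN CONDITIONS holds at the (negative) roots of ONE
# of the two parts — at the roots of `h` (`g·h′ > 0`, Hermite–Biehler) or at the roots of `g` (`h·g′ < 0` and `h(0)g(0) > 0`, Hermite–Biehler after one descending Routh step) — so that if
# `h_m ≤ h ≤ h_M` pointwise on `(−∞, 0]` and both `(h_m, g)`, `(h_M, g)` are Hurwitz then `(h, g)` is Hurwitz, and likewise for `g_m ≤ g ≤ g_M`** (both parities)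

HONEST FRAMING. Part of the Lean index of the computation cell `pub-hsemireg` (seat p10 gen 41, Sunday typer «UNIFORM-IN-n»).
REAL POLYNOMIALS ONLY (this lineage's Hermite–Biehler theorem N203 ∕ N239, the descending Routh step N230 and the coefficient lemmas N229 ∕ N230): no variety, no cohomology theory, no sheaf, no
Ext group and no semiregularity map is constructed here; nothing here says that HC / HC_CM / HC_AV holds; no Literature fact (unproved `Prop`) is declared or used.  Custodian versions as in
`WedgeHankelSiegelIdeal` (1/3).
SOURCES (cited).  V. L. Kharitonov, *Asymptotic stability of an equilibrium position of a family of systems of linear differential equations*, Differ. Uravn. 14 (1978) 2086–2088 (the theorem);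
R. J. Minnichelli, J. J. Anagnost, C. A. Desoer, *An elementary proof of Kharitonov's stability theorem with extensions*, IEEE Trans. Automat. Control 34 (1989) 995–998 (proof through the
Hermite–Biehler interlacing theorem); S. P. Bhattacharyya, H. Chapellat, L. H. Keel, *Robust Control: The Parametric Approach* (1995), Ch. 5 (Kharitonov's theorem, vertex lemmas); F. R.
Gantmacher, *The Theory of Matrices* II, Ch. XV §14 Thm 13 (Hermite–Biehler in positive-pair form; typed N203 ∕ N239 ∕ N240) and §3 (13)∕(15) (the descending Routh step; typed N230).
PROOF TYPED HERE (a standard route, not a transcription of one printed page): (1) Hermite–Biehler, even degree (N203 `forall_re_neg_iff_hermiteBiehler_of_even`): Hurwitz ⟺ `h` has simple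
negative real roots `x` with `g(x)h′(x) > 0` — the ONLY dependence on `g` is through the values `g(x)` at points `x < 0`, so `g_m(x) ≤ g(x) ≤ g_M(x)` on `x ≤ 0` transfers the condition; (2) odd
degree (N203 `…_of_odd`): Hurwitz ⟺ `g` has simple negative roots `y` with `h(y)g′(y) < 0` and `h(0)g(0) > 0` — depends on `h` only through `h(0)`, `h(y)`, `y < 0`; (3) the two MIXED criteria
(even degree at the roots of `g`, odd degree at the roots of `h`) follow from (1)∕(2) after ONE descending Routh step (N230), which replaces `h` by `h − c·X·g` (resp. `g` by `g − c·h`) without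
changing the values at the roots of `g` (resp. `h`) or at `0`.
DICTIONARY.  Hurwitz = `∀ z ∈ roots of (expand 2 h + X·expand 2 g) over ℂ, re z < 0`; even degree `2m + 4`: `deg h = m + 2`, `deg g ≤ m + 1`; odd degree `2m + 3`: `deg g = m + 1 ≥ deg h`;
«between on `(−∞, 0]`» = `∀ x ≤ 0, h_m(x) ≤ h(x) ≤ h_M(x)`.
DEDUP DISCLOSURE (`rg -n 'Kharitonov|between|envelope' Summits/Ventures/HSemireg`, 2026-09-02): N227 `…KharitonovCubic` (degrees 2, 3 by explicit inequalities); nothing for general degree.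
The 7 names below: 0 hits tree-wide (a first draft re-derived N232's odd criterion under the same name — caught by the standalone check, dropped).

WHAT IS IN THE TREE.  N203 `forall_re_neg_iff_hermiteBiehler_of_even ∕ _of_odd`; N232 `forall_re_neg_iff_roots_even_part_of_odd`; N230 `forall_re_neg_iff_routh_descending_of_even ∕ _of_odd`, `natDegree_sub_C_mul_le`; N229
`natDegree_sub_C_mul_X_mul_le` (N230's `natDegree_sub_C_mul_le` is no longer needed); N239 `forall_re_neg_iff_interlacing` (gives `deg g = m + 1`, `lc g > 0` in even degree).
THIS FILE (namespace `Summit.Ventures.HSemireg.Wedge.HankelOuter` continued; CHAINED on N239 (which imports N230 ∕ N203); 0 definitions):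
* §1017 THE MIXED CRITERION, EVEN DEGREE: **`forall_re_neg_iff_roots_odd_part_of_even`** (even degree `2m+4`, `deg h = m+2`, `deg g = m+1`, `lc g > 0`: Hurwitz ⟺ `lc h > 0 ∧ g` splits
  with simple negative roots `y`, `h(y)g′(y) < 0`, and `h(0)g(0) > 0`) — the odd-degree twin (criterion at the roots of `h`) is ALREADY N232's `forall_re_neg_iff_roots_even_part_of_odd` and is used as is.
* §1018 THE FOUR VERTEX LEMMAS: **`forall_re_neg_of_between_odd_part_of_even`** (vary `g`, even), **`forall_re_neg_of_between_even_part_of_odd`** (vary `h`, odd),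
  **`forall_re_neg_of_between_even_part_of_even`** (vary `h`, even degree `≥ 4`), **`forall_re_neg_of_between_odd_part_of_odd`** (vary `g`, odd).
CAVEATS.  Even degree `2` is not covered by the `h`-variation lemma (it is N227's `forall_re_neg_box_iff_of_natDegree_two`).  Kharitonov's theorem itself (boxes, the four polynomials) is the
next leaf.  Nothing Ext-side.  New names only.
-/

open Module Polynomial
open scoped Matrix Polynomial

namespace Summit.Ventures.HSemireg.Wedge.HankelOuter

/-! ## §1017. The mixed criteria: conditions at the roots of the other part -/

/-- **Even degree `2m + 4`, criterion at the roots of `g`** (`deg h = m + 2`, `deg g = m + 1`, `lc g > 0`): `h(X²) + X·g(X²)` is Hurwitz iff `lc h > 0`, `g` splits over `ℝ` with simple negative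
roots `y` at which `h(y)·g′(y) < 0`, and `h(0)·g(0) > 0` — one descending Routh step (`h ↦ h − (lc h/lc g)·X·g`, which changes neither `h(0)` nor `h` at the roots of `g`) followed by
Hermite–Biehler in odd degree. [Kharitonov 1978 via Minnichelli–Anagnost–Desoer 1989; Gantmacher XV §3 (15) + Thm 13; this file, §1017] -/
theorem forall_re_neg_iff_roots_odd_part_of_even (m : ℕ) {h g : ℝ[X]} (hh : h.natDegree = m + 2) (hg : g.natDegree = m + 1) (hglc : 0 < g.leadingCoeff) :
    (∀ z ∈ ((expand ℝ 2 h + Polynomial.X * expand ℝ 2 g).map (algebraMap ℝ ℂ)).roots, z.re < 0)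
      ↔ 0 < h.leadingCoeff ∧ g.Splits ∧ g.Separable ∧ 0 < h.eval 0 * g.eval 0 ∧ ∀ y ∈ g.roots, y < 0 ∧ h.eval y * (derivative g).eval y < 0 := by
  rw [forall_re_neg_iff_routh_descending_of_even m hh hg]
  have hdeg : (h - C (h.leadingCoeff / g.leadingCoeff) * (Polynomial.X * g)).natDegree ≤ m + 1 := by
    have h1 : g.leadingCoeff = g.coeff (m + 1) := by rw [leadingCoeff, hg]
    have h2 : h.leadingCoeff = h.coeff (m + 2) := by rw [leadingCoeff, hh]
    rw [h1, h2]
    exact natDegree_sub_C_mul_X_mul_le (k := m + 1) hg.le (by rw [← h1]; exact hglc.ne') hh.le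
  rw [forall_re_neg_iff_hermiteBiehler_of_odd m hg hdeg hglc, div_pos_iff_of_pos_right hglc]
  have h0 : (h - C (h.leadingCoeff / g.leadingCoeff) * (Polynomial.X * g)).eval 0 = h.eval 0 := by
    rw [eval_sub, eval_mul, eval_mul, eval_C, eval_X, zero_mul, mul_zero, sub_zero]
  rw [h0]
  refine and_congr_right fun _ => and_congr_right fun _ => and_congr_right fun _ => and_congr_right fun _ => forall₂_congr fun y hy => and_congr_right fun _ => ?_
  have hroot : g.eval y = 0 := (mem_roots (leadingCoeff_ne_zero.1 hglc.ne')).1 hy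
  rw [eval_sub, eval_mul, eval_mul, eval_C, hroot, mul_zero, mul_zero, sub_zero]

/-! ## §1018. The four vertex lemmas -/

/-- A value squeezed between two values whose products with `a` are positive has positive product with `a`. [folklore; this file, §1018] -/
theorem mul_pos_of_between {a b bm bM : ℝ} (hm : 0 < bm * a) (hM : 0 < bM * a) (h1 : bm ≤ b) (h2 : b ≤ bM) : 0 < b * a := by
  rcases le_or_gt 0 a with ha | ha
  · exact hm.trans_le (mul_le_mul_of_nonneg_right h1 ha)
  · exact hM.trans_le (mul_le_mul_of_nonpos_right h2 ha.le)

/-- A value squeezed between two values whose products with `a` are negative has negative product with `a`. [folklore; this file, §1018] -/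
theorem mul_neg_of_between {a b bm bM : ℝ} (hm : bm * a < 0) (hM : bM * a < 0) (h1 : bm ≤ b) (h2 : b ≤ bM) : b * a < 0 := by
  rcases le_or_gt 0 a with ha | ha
  · exact (mul_le_mul_of_nonneg_right h2 ha).trans_lt hM
  · exact (mul_le_mul_of_nonpos_right h1 ha.le).trans_lt hm

/-- **VERTEX LEMMA 1 (even degree, vary the odd part):** `deg h = m + 1`, `lc h > 0`, `deg g, deg g_m, deg g_M ≤ m`; if `(h, g_m)` and `(h, g_M)` are Hurwitz and `g_m ≤ g ≤ g_M` on `(−∞, 0]`,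
then `(h, g)` is Hurwitz. [Kharitonov 1978; Minnichelli–Anagnost–Desoer 1989 (Hermite–Biehler route); this file, §1018] -/
theorem forall_re_neg_of_between_odd_part_of_even (m : ℕ) {h g gm gM : ℝ[X]} (hh : h.natDegree = m + 1) (hlc : 0 < h.leadingCoeff) (hg : g.natDegree ≤ m)
    (hgm : gm.natDegree ≤ m) (hgM : gM.natDegree ≤ m)
    (Hm : ∀ z ∈ ((expand ℝ 2 h + Polynomial.X * expand ℝ 2 gm).map (algebraMap ℝ ℂ)).roots, z.re < 0)
    (HM : ∀ z ∈ ((expand ℝ 2 h + Polynomial.X * expand ℝ 2 gM).map (algebraMap ℝ ℂ)).roots, z.re < 0)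
    (hbet : ∀ x : ℝ, x ≤ 0 → gm.eval x ≤ g.eval x ∧ g.eval x ≤ gM.eval x) :
    ∀ z ∈ ((expand ℝ 2 h + Polynomial.X * expand ℝ 2 g).map (algebraMap ℝ ℂ)).roots, z.re < 0 := by
  rw [forall_re_neg_iff_hermiteBiehler_of_even m hh hgm hlc] at Hm
  rw [forall_re_neg_iff_hermiteBiehler_of_even m hh hgM hlc] at HM
  rw [forall_re_neg_iff_hermiteBiehler_of_even m hh hg hlc]
  refine ⟨Hm.1, Hm.2.1, fun x hx => ⟨(Hm.2.2 x hx).1, ?_⟩⟩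
  have hb := hbet x (Hm.2.2 x hx).1.le
  exact mul_pos_of_between (Hm.2.2 x hx).2 (HM.2.2 x hx).2 hb.1 hb.2

/-- **VERTEX LEMMA 2 (odd degree, vary the even part):** `deg g = m + 1`, `lc g > 0`, `deg h, deg h_m, deg h_M ≤ m + 1`; if `(h_m, g)` and `(h_M, g)` are Hurwitz and `h_m ≤ h ≤ h_M` on
`(−∞, 0]`, then `(h, g)` is Hurwitz. [Kharitonov 1978; Minnichelli–Anagnost–Desoer 1989; this file, §1018] -/
theorem forall_re_neg_of_between_even_part_of_odd (m : ℕ) {h hm hM g : ℝ[X]} (hg : g.natDegree = m + 1) (hglc : 0 < g.leadingCoeff) (hh : h.natDegree ≤ m + 1)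
    (hhm : hm.natDegree ≤ m + 1) (hhM : hM.natDegree ≤ m + 1)
    (Hm : ∀ z ∈ ((expand ℝ 2 hm + Polynomial.X * expand ℝ 2 g).map (algebraMap ℝ ℂ)).roots, z.re < 0)
    (HM : ∀ z ∈ ((expand ℝ 2 hM + Polynomial.X * expand ℝ 2 g).map (algebraMap ℝ ℂ)).roots, z.re < 0)
    (hbet : ∀ x : ℝ, x ≤ 0 → hm.eval x ≤ h.eval x ∧ h.eval x ≤ hM.eval x) :
    ∀ z ∈ ((expand ℝ 2 h + Polynomial.X * expand ℝ 2 g).map (algebraMap ℝ ℂ)).roots, z.re < 0 := by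
  rw [forall_re_neg_iff_hermiteBiehler_of_odd m hg hhm hglc] at Hm
  rw [forall_re_neg_iff_hermiteBiehler_of_odd m hg hhM hglc] at HM
  rw [forall_re_neg_iff_hermiteBiehler_of_odd m hg hh hglc]
  refine ⟨Hm.1, Hm.2.1, ?_, fun y hy => ⟨(Hm.2.2.2 y hy).1, ?_⟩⟩
  · have hb := hbet 0 le_rfl
    exact mul_pos_of_between Hm.2.2.1 HM.2.2.1 hb.1 hb.2
  · have hb := hbet y (Hm.2.2.2 y hy).1.le
    exact mul_neg_of_between (Hm.2.2.2 y hy).2 (HM.2.2.2 y hy).2 hb.1 hb.2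

/-- **VERTEX LEMMA 3 (even degree `2m + 4 ≥ 4`, vary the even part):** `deg h = deg h_m = deg h_M = m + 2` with `lc h, lc h_m > 0`, `deg g ≤ m + 1`; if `(h_m, g)` and `(h_M, g)` are
Hurwitz and `h_m ≤ h ≤ h_M` on `(−∞, 0]`, then `(h, g)` is Hurwitz (Hurwitz-ness of `(h_m, g)` forces `deg g = m + 1`, `lc g > 0`; then the criterion at the roots of `g`).
[Kharitonov 1978; Minnichelli–Anagnost–Desoer 1989; this file, §1018] -/
theorem forall_re_neg_of_between_even_part_of_even (m : ℕ) {h hm hM g : ℝ[X]} (hh : h.natDegree = m + 2) (hlc : 0 < h.leadingCoeff)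
    (hhm : hm.natDegree = m + 2) (hmlc : 0 < hm.leadingCoeff) (hhM : hM.natDegree = m + 2) (hg : g.natDegree ≤ m + 1)
    (Hm : ∀ z ∈ ((expand ℝ 2 hm + Polynomial.X * expand ℝ 2 g).map (algebraMap ℝ ℂ)).roots, z.re < 0)
    (HM : ∀ z ∈ ((expand ℝ 2 hM + Polynomial.X * expand ℝ 2 g).map (algebraMap ℝ ℂ)).roots, z.re < 0)
    (hbet : ∀ x : ℝ, x ≤ 0 → hm.eval x ≤ h.eval x ∧ h.eval x ≤ hM.eval x) :
    ∀ z ∈ ((expand ℝ 2 h + Polynomial.X * expand ℝ 2 g).map (algebraMap ℝ ℂ)).roots, z.re < 0 := by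
  -- `deg g = m + 1` and `lc g > 0` from the interlacing form of Hermite–Biehler for `(h_m, g)`
  obtain ⟨u, w, -, -, -, -, hgdeg, hglc, -⟩ := (forall_re_neg_iff_interlacing (m + 1) hhm hg hmlc).1 Hm
  rw [forall_re_neg_iff_roots_odd_part_of_even m hhm hgdeg hglc] at Hm
  rw [forall_re_neg_iff_roots_odd_part_of_even m hhM hgdeg hglc] at HM
  rw [forall_re_neg_iff_roots_odd_part_of_even m hh hgdeg hglc]
  refine ⟨hlc, Hm.2.1, Hm.2.2.1, ?_, fun y hy => ⟨(Hm.2.2.2.2 y hy).1, ?_⟩⟩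
  · have hb := hbet 0 le_rfl
    exact mul_pos_of_between Hm.2.2.2.1 HM.2.2.2.1 hb.1 hb.2
  · have hb := hbet y (Hm.2.2.2.2 y hy).1.le
    exact mul_neg_of_between (Hm.2.2.2.2 y hy).2 (HM.2.2.2.2 y hy).2 hb.1 hb.2

/-- **VERTEX LEMMA 4 (odd degree `2m + 3`, vary the odd part):** `deg h = m + 1` with `lc h > 0`, `deg g = deg g_m = deg g_M = m + 1`; if `(h, g_m)` and `(h, g_M)` are Hurwitz and
`g_m ≤ g ≤ g_M` on `(−∞, 0]`, and `lc g > 0`, then `(h, g)` is Hurwitz (criterion at the roots of `h`). [Kharitonov 1978; Minnichelli–Anagnost–Desoer 1989; this file, §1018] -/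
theorem forall_re_neg_of_between_odd_part_of_odd (m : ℕ) {h g gm gM : ℝ[X]} (hh : h.natDegree = m + 1) (hlc : 0 < h.leadingCoeff) (hg : g.natDegree = m + 1) (hglc : 0 < g.leadingCoeff)
    (hgm : gm.natDegree = m + 1) (hgM : gM.natDegree = m + 1)
    (Hm : ∀ z ∈ ((expand ℝ 2 h + Polynomial.X * expand ℝ 2 gm).map (algebraMap ℝ ℂ)).roots, z.re < 0)
    (HM : ∀ z ∈ ((expand ℝ 2 h + Polynomial.X * expand ℝ 2 gM).map (algebraMap ℝ ℂ)).roots, z.re < 0)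
    (hbet : ∀ x : ℝ, x ≤ 0 → gm.eval x ≤ g.eval x ∧ g.eval x ≤ gM.eval x) :
    ∀ z ∈ ((expand ℝ 2 h + Polynomial.X * expand ℝ 2 g).map (algebraMap ℝ ℂ)).roots, z.re < 0 := by
  rw [forall_re_neg_iff_roots_even_part_of_odd m hgm hh hlc] at Hm
  rw [forall_re_neg_iff_roots_even_part_of_odd m hgM hh hlc] at HM
  rw [forall_re_neg_iff_roots_even_part_of_odd m hg hh hlc]
  refine ⟨⟨Hm.1.1, Hm.1.2.1, fun x hx => ⟨(Hm.1.2.2 x hx).1, ?_⟩⟩, div_pos hglc hlc⟩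
  have hb := hbet x (Hm.1.2.2 x hx).1.le
  exact mul_pos_of_between (Hm.1.2.2 x hx).2 (HM.1.2.2 x hx).2 hb.1 hb.2

end Summit.Ventures.HSemireg.Wedge.HankelOuter
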